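import Mathlib
import HarnessLib
import Summits.ResolutionOfSingularities.ResolutionOfSingularities.Theorems.WildQuotientsWildQuotientResolutionZ9PeeledTwistedLift

/-!
# ℤ9 SPECIMEN (peeled `𝔸⁴/ℤ9`, char 3), brick Z4T part 1b: the twisted lift `σ̃` has ORDER 3
# and EXISTS as a `k`-algebra automorphism of the twisted root chart ring `L = k[x][u⁻¹]`
(crux stmt-ResolutionOfSingularities-15640 `WildQuotients.WildQuotientResolution`, line `Sketch`; S1 =
stmt-ResolutionOfSingularities-17941 `CyclicQuotientFourfolds`, non-linear sector; chain w45c card-P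
specimen «peeled 𝔸⁴/ℤ9», variant V-BR — res-L1-w45c-idea-2 design
`L/res-L1-w45c-idea-2/cardP_g12/Z4T-TWIST.md` 75f51c076580e517 §2, res-L1-w45c-plan-1 GO
2026-08-27T16:29:20Z, CHAIN v9.3 §4 «Z4T = stub-2», res-L1-w45c-stub-2 SIG 17:39:44Z. [OURS · L1 W4.5c] —
NOT a statement of any manuscript; replaces the role of no printed item; AI-produced, kernel-checked ≠
expert-reviewed. Def-free, LAW-BASED.)

SETTING (letters of res-L1-w45c-stub-1's Z0 / res-D-pv-033's Z2–Z3). `k` a field, `k[x] = k[x₁,…,xₙ]`,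
indices `a b c d` (`x_a, x_b, x_c` = the `J₃`-type coordinates of the peeled action, `x_d` = the peel
coordinate `w`), the peeled automorphism `σ̄`: `x_b ↦ x_b + x_a`, `x_c ↦ x_c + x_b`,
`x_d ↦ x_d + x_c³ − x_a²x_c`, all other variables (in particular `x_a`) fixed. TWISTED ROOT SLOTS reuse
`k[x]`: `S ↔ X b`, `α ↔ X a`, `γ ↔ X c`, `w ↔ X d`; `u := 1 − S⁶α²`, `v := 1 + S³α`, `v' := 1 − S³α`
(`u = v·v'`); the twisted root chart ring is `L := k[x][u⁻¹]` (`Localization.Away u`, an OPEN SUBSET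
of `𝔸ⁿ`), `ι : k[x] → L`, `J := u⁻¹ ∈ L`, `iv := ι v'·J = (ι v)⁻¹`, `iv' := ι v·J = (ι v')⁻¹`.

* `ψ_T` (the twisted substitution, POLYNOMIAL): `x_a ↦ S⁷αu`, `x_b ↦ S⁴u`, `x_c ↦ Sγ`, `x_d ↦ x_d`,
  passengers fixed (memo §2: `A = x_a/x_b ↦ S³α`; `twist_N1`: `N₁ = x_b(x_b+x_a)(x_b−x_a) ↦ (S³u)⁴` —
  the chart adjoins the FOURTH ROOT of the invariant norm `N₁`).
* LAWS of a lift `τ : L →ₐ[k] L` of `σ̄` (division-free): `τ (ι S) = ι (S·v)`, `τ (ι α) = ι α · iv⁴`,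
  `τ (ι γ) = ι γ · iv + ι (S³ v')`, `τ (ι w) = ι (w + S³γ³ − S¹⁵α²u²γ)`, passengers fixed.
* THIS FILE (companion of `…Z9PeeledTwistedLift`, which has `ψ_T`, the relations of `L`, the
  `lift_apply_*` lemmas and `lift_comp_twist`): **`lift_cube_apply_S`**, **`lift_cube_apply_twist`**,
  **`lift_cube_eq_id`** (`τ³ = id` on all of `L`, given `σ̄³ = 1`: `ι S` directly, `ι u, ι α, ι γ` by
  cancellation in the domain `L` from the `ψ_T`-images `S⁴u, S⁷αu, Sγ`, `ι x_d` and the passengers as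
  `ψ_T`-images, `J = u⁻¹` by uniqueness of inverses; `IsLocalization.ringHom_ext`),
  **`exists_twistedLift`** (`σ̃ : L ≃ₐ[k] L` with the laws and `σ̃ ^ 3 = 1`, via
  `IsLocalization.Away.liftAlgHom` of the substitution `ψ₀` — `ψ₀(u) = v'·iv²` is a unit — inverted by
  its own square), `twistedLift_ne_one`.
Characteristic `3` enters exactly at `v² − S⁶α² = v'` (`1 + 2S³α = 1 − S³α`).
Part 2 (`…Z9PeeledTwistedKL`): `σ̃z − z ∈ (S³)`, the unit certificate, K–L ⇒ `L^{σ̃}` regular.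
ENGINEERING: every law is an explicit THEOREM binder (a `variable` whose type uses a file-local
`notation3` elaborates to `sorry` inside theorems on the farm — res-L1-w45c-stub-2 16:06:49Z); inside
proofs only `map_mul`/`map_pow` are used as simp lemmas so that `ι v`, `ι v'`, `ι u` stay atoms, and the
identities are closed by `linear_combination` over the relations `ι v·(ι v'·J) = 1`, `ι u = ι v·ι v'`,
`ι v = 1 + (ι S)³ ι α`, `ι v' = 1 − (ι S)³ ι α`, `3 = 0` (cofactors machine-checked off-line).
-/

-- single-problem summit: the doubled namespace component `ResolutionOfSingularities` is forced
set_option linter.dupNamespace false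

noncomputable section

open MvPolynomial

namespace Summit.ResolutionOfSingularities.ResolutionOfSingularities.Theorems.WildQuotientResolution.Z9Peeled

variable (k : Type) [Field k] (n : ℕ) (a b c d : Fin n)

/-- `u = 1 − S⁶α²` (local shorthand; slots `S = X b`, `α = X a`). -/
local notation3 "uT" => (1 - X b ^ 6 * X a ^ 2 : MvPolynomial (Fin n) k)
/-- `v = 1 + S³α` (local shorthand). -/
local notation3 "vT" => (1 + X b ^ 3 * X a : MvPolynomial (Fin n) k)
/-- `v' = 1 − S³α` (local shorthand). -/
local notation3 "vT'" => (1 - X b ^ 3 * X a : MvPolynomial (Fin n) k)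
/-- The twisted root chart ring `L = k[x][u⁻¹]` (local shorthand). -/
local notation3 "LT" => Localization.Away (1 - X b ^ 6 * X a ^ 2 : MvPolynomial (Fin n) k)
/-- `ι : k[x] → L` (local shorthand). -/
local notation3 "ιT" => algebraMap (MvPolynomial (Fin n) k)
  (Localization.Away (1 - X b ^ 6 * X a ^ 2 : MvPolynomial (Fin n) k))
/-- `J = u⁻¹ ∈ L` (local shorthand). -/
local notation3 "JT" => (IsLocalization.Away.invSelf (1 - X b ^ 6 * X a ^ 2 : MvPolynomial (Fin n) k) :
  Localization.Away (1 - X b ^ 6 * X a ^ 2 : MvPolynomial (Fin n) k))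
/-- `iv = (ι v)⁻¹ = ι v'·J` (local shorthand). -/
local notation3 "ivT" => (algebraMap (MvPolynomial (Fin n) k)
  (Localization.Away (1 - X b ^ 6 * X a ^ 2 : MvPolynomial (Fin n) k)) (1 - X b ^ 3 * X a) *
    (IsLocalization.Away.invSelf (1 - X b ^ 6 * X a ^ 2 : MvPolynomial (Fin n) k) :
      Localization.Away (1 - X b ^ 6 * X a ^ 2 : MvPolynomial (Fin n) k)))
/-- `iv' = (ι v')⁻¹ = ι v·J` (local shorthand). -/
local notation3 "ivT'" => (algebraMap (MvPolynomial (Fin n) k)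
  (Localization.Away (1 - X b ^ 6 * X a ^ 2 : MvPolynomial (Fin n) k)) (1 + X b ^ 3 * X a) *
    (IsLocalization.Away.invSelf (1 - X b ^ 6 * X a ^ 2 : MvPolynomial (Fin n) k) :
      Localization.Away (1 - X b ^ 6 * X a ^ 2 : MvPolynomial (Fin n) k)))
/-- The twisted substitution `ψ_T` (local shorthand): `x_a ↦ S⁷αu`, `x_b ↦ S⁴u`, `x_c ↦ Sγ`, rest fixed. -/
local notation3 "twT" => (fun i : Fin n => if i = a then X b ^ 7 * X a * (1 - X b ^ 6 * X a ^ 2)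
    else if i = b then X b ^ 4 * (1 - X b ^ 6 * X a ^ 2) else if i = c then X b * X c
    else (X i : MvPolynomial (Fin n) k))

/-! ## `σ̃³ = 1` -/

/-- `τ² (ι S) = ι S · ι v'` and **`τ³ (ι S) = ι S`** (char 3). [OURS · L1 W4.5c] -/
theorem lift_cube_apply_S [CharP k 3] (τ : LT →ₐ[k] LT)
    (hS : τ (ιT (X b)) = ιT (X b * vT)) (hA : τ (ιT (X a)) = ιT (X a) * ivT ^ 4) :
    τ (τ (ιT (X b))) = ιT (X b) * ιT vT' ∧ τ (τ (τ (ιT (X b)))) = ιT (X b) := by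
  have hJ := algebraMap_v_mul_iv k n a b
  have hv := lift_apply_v k n a b τ hS hA
  have hv' := lift_apply_v' k n a b τ hS hA
  simp only [map_mul] at hS
  have h2 : τ (τ (ιT (X b))) = ιT (X b) * ιT vT' := by
    rw [hS, map_mul, hS, hv]
    linear_combination (ιT (X b) * ιT vT') * hJ
  refine ⟨h2, ?_⟩
  rw [h2, map_mul, hS, hv']
  linear_combination (ιT (X b)) * hJ

/-- **`τ³ = id` on the `ψ_T`-images**: `τ³ (ι (ψ_T F)) = ι (ψ_T F)` (from `lift_comp_twist` and
`σ̄³ = 1`). [OURS · L1 W4.5c] -/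
theorem lift_cube_apply_twist [CharP k 3] (σ : MvPolynomial (Fin n) k ≃ₐ[k] MvPolynomial (Fin n) k)
    (hb : σ (X b) = X b + X a) (hc : σ (X c) = X c + X b)
    (hd : σ (X d) = X d + X c ^ 3 - X a ^ 2 * X c)
    (hσ : ∀ i, i ≠ b → i ≠ c → i ≠ d → σ (X i) = X i) (hσ3 : σ ^ 3 = 1)
    (hab : a ≠ b) (hac : a ≠ c) (had : a ≠ d) (hbc : b ≠ c) (hbd : b ≠ d) (hcd : c ≠ d)
    (τ : LT →ₐ[k] LT)
    (hS : τ (ιT (X b)) = ιT (X b * vT)) (hA : τ (ιT (X a)) = ιT (X a) * ivT ^ 4)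
    (hG : τ (ιT (X c)) = ιT (X c) * ivT + ιT (X b ^ 3 * vT'))
    (hW : τ (ιT (X d)) = ιT (X d + X b ^ 3 * X c ^ 3 - X b ^ 15 * X a ^ 2 * uT ^ 2 * X c))
    (hfix : ∀ i, i ≠ a → i ≠ b → i ≠ c → i ≠ d → τ (ιT (X i)) = ιT (X i))
    (F : MvPolynomial (Fin n) k) :
    τ (τ (τ (ιT (aeval twT F)))) = ιT (aeval twT F) := by
  have h := fun F => lift_comp_twist k n a b c d σ hb hc hd hσ hab hac had hbc hbd hcd τ hS hA hG hW
    hfix F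
  rw [h, h, h, ← AlgEquiv.mul_apply, ← AlgEquiv.mul_apply, ← pow_two, ← pow_succ, hσ3,
    AlgEquiv.one_apply]

/-- **`τ³ = id` on all of `L`** (char 3, `σ̄³ = 1`): `τ³` fixes `ι S` (`lift_cube_apply_S`), hence
`ι u` and `ι α` (from the `ψ_T`-images `S⁴u`, `S⁷αu` and cancellation in the domain `L`), `ι γ` (from
`Sγ`), `ι x_d` and the passengers (they are `ψ_T`-images), and `J = u⁻¹` (inverses are unique); so
`τ ∘ τ ∘ τ = id` by `IsLocalization.ringHom_ext`. [OURS · L1 W4.5c] -/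
theorem lift_cube_eq_id [CharP k 3] (σ : MvPolynomial (Fin n) k ≃ₐ[k] MvPolynomial (Fin n) k)
    (hb : σ (X b) = X b + X a) (hc : σ (X c) = X c + X b)
    (hd : σ (X d) = X d + X c ^ 3 - X a ^ 2 * X c)
    (hσ : ∀ i, i ≠ b → i ≠ c → i ≠ d → σ (X i) = X i) (hσ3 : σ ^ 3 = 1)
    (hab : a ≠ b) (hac : a ≠ c) (had : a ≠ d) (hbc : b ≠ c) (hbd : b ≠ d) (hcd : c ≠ d)
    (τ : LT →ₐ[k] LT)
    (hS : τ (ιT (X b)) = ιT (X b * vT)) (hA : τ (ιT (X a)) = ιT (X a) * ivT ^ 4)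
    (hG : τ (ιT (X c)) = ιT (X c) * ivT + ιT (X b ^ 3 * vT'))
    (hW : τ (ιT (X d)) = ιT (X d + X b ^ 3 * X c ^ 3 - X b ^ 15 * X a ^ 2 * uT ^ 2 * X c))
    (hfix : ∀ i, i ≠ a → i ≠ b → i ≠ c → i ≠ d → τ (ιT (X i)) = ιT (X i)) :
    τ.comp (τ.comp τ) = AlgHom.id k LT := by
  classical
  -- `L` is a domain and `ι` is injective (`u ≠ 0` in the domain `k[x]`)
  have hu0 : uT ≠ 0 := by
    intro h
    have h' := congrArg MvPolynomial.constantCoeff h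
    simp [MvPolynomial.constantCoeff_X] at h'
  haveI : IsDomain LT :=
    IsLocalization.isDomain_of_le_nonZeroDivisors _ (powers_le_nonZeroDivisors_of_noZeroDivisors hu0)
  have hinj : Function.Injective ιT :=
    IsLocalization.injective LT (powers_le_nonZeroDivisors_of_noZeroDivisors hu0)
  have hS0 : ιT (X b) ≠ 0 := fun h => X_ne_zero b (hinj (by rw [h, map_zero]))
  have hcube := fun F => lift_cube_apply_twist k n a b c d σ hb hc hd hσ hσ3 hab hac had hbc hbd hcd τ hS
    hA hG hW hfix F
  have h3S := (lift_cube_apply_S k n a b τ hS hA).2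
  -- `τ³ (ι u) = ι u` from the image `S⁴u = ψ_T (x_b)`
  have h3U : τ (τ (τ (ιT uT))) = ιT uT := by
    have h := hcube (X b)
    rw [twist_X_b k n a b c hab] at h
    simp only [map_mul, map_pow] at h
    rw [h3S] at h
    exact mul_left_cancel₀ (pow_ne_zero 4 hS0) h
  -- `τ³ (ι α) = ι α` from the image `S⁷αu = ψ_T (x_a)`
  have hU0 : ιT uT ≠ 0 := fun h => hu0 (hinj (by rw [h, map_zero]))
  have h3A : τ (τ (τ (ιT (X a)))) = ιT (X a) := by
    have h := hcube (X a)
    rw [twist_X_a] at h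
    simp only [map_mul, map_pow] at h
    rw [h3S, h3U] at h
    have h' : ιT (X b) ^ 7 * ιT uT * τ (τ (τ (ιT (X a)))) = ιT (X b) ^ 7 * ιT uT * ιT (X a) := by
      linear_combination h
    exact mul_left_cancel₀ (mul_ne_zero (pow_ne_zero 7 hS0) hU0) h'
  -- `τ³ (ι γ) = ι γ` from the image `Sγ = ψ_T (x_c)`
  have h3G : τ (τ (τ (ιT (X c)))) = ιT (X c) := by
    have h := hcube (X c)
    rw [twist_X_c k n a b c hac hbc] at h
    simp only [map_mul] at h
    rw [h3S] at h
    exact mul_left_cancel₀ hS0 h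
  -- `τ³ J = J`
  have h3J : τ (τ (τ JT)) = JT := by
    have h1 := algebraMap_u_mul_J k n a b
    have h := congrArg (fun y => τ (τ (τ y))) h1
    simp only [map_mul, map_one] at h
    rw [h3U] at h
    linear_combination JT * h - (τ (τ (τ JT))) * h1
  -- assemble
  apply AlgHom.coe_ringHom_injective
  refine IsLocalization.ringHom_ext (Submonoid.powers uT) ?_
  refine MvPolynomial.ringHom_ext (fun r => ?_) (fun i => ?_)
  · change τ (τ (τ (ιT (C r)))) = ιT (C r)
    have h : ιT (C r) = algebraMap k LT r := by
      rw [← MvPolynomial.algebraMap_eq]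
      exact (IsScalarTower.algebraMap_apply k (MvPolynomial (Fin n) k) LT r).symm
    rw [h, AlgHom.commutes, AlgHom.commutes, AlgHom.commutes]
  · change τ (τ (τ (ιT (X i)))) = ιT (X i)
    by_cases hia : i = a
    · rw [hia]; exact h3A
    by_cases hib : i = b
    · rw [hib]; exact h3S
    by_cases hic : i = c
    · rw [hic]; exact h3G
    by_cases hid : i = d
    · have h := hcube (X d)
      rw [twist_X_of_ne k n a b c had.symm hbd.symm hcd.symm] at h
      rw [hid]
      exact h
    · rw [hfix i hia hib hic hid, hfix i hia hib hic hid, hfix i hia hib hic hid]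

/-! ## Existence of the lift -/

-- the unit computation and the cube run over the long law binders; head-room
set_option maxHeartbeats 1600000 in
/-- **The twisted lift exists**: in characteristic `3`, for the peeled `σ̄` with `σ̄³ = 1` there is a
`k`-algebra automorphism `σ̃` of the twisted root chart ring `L = k[x][u⁻¹]` with the laws
`σ̃ (ι S) = ι (S·v)`, `σ̃ (ι α) = ι α · iv⁴`, `σ̃ (ι γ) = ι γ · iv + ι (S³ v')`,
`σ̃ (ι w) = ι (w + S³γ³ − S¹⁵α²u²γ)`, passengers fixed, and `σ̃ ^ 3 = 1` (construction:
`IsLocalization.Away.liftAlgHom` of the substitution `ψ₀` — `ψ₀(u) = v'·iv²` is a unit — inverted by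
its own square, `lift_cube_eq_id`). [OURS · L1 W4.5c] -/
theorem exists_twistedLift [CharP k 3] (σ : MvPolynomial (Fin n) k ≃ₐ[k] MvPolynomial (Fin n) k)
    (hb : σ (X b) = X b + X a) (hc : σ (X c) = X c + X b)
    (hd : σ (X d) = X d + X c ^ 3 - X a ^ 2 * X c)
    (hσ : ∀ i, i ≠ b → i ≠ c → i ≠ d → σ (X i) = X i) (hσ3 : σ ^ 3 = 1)
    (hab : a ≠ b) (hac : a ≠ c) (had : a ≠ d) (hbc : b ≠ c) (hbd : b ≠ d) (hcd : c ≠ d) :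
    ∃ σt : LT ≃ₐ[k] LT,
      σt (ιT (X b)) = ιT (X b * vT) ∧ σt (ιT (X a)) = ιT (X a) * ivT ^ 4 ∧
      σt (ιT (X c)) = ιT (X c) * ivT + ιT (X b ^ 3 * vT') ∧
      σt (ιT (X d)) = ιT (X d + X b ^ 3 * X c ^ 3 - X b ^ 15 * X a ^ 2 * uT ^ 2 * X c) ∧
      (∀ i, i ≠ a → i ≠ b → i ≠ c → i ≠ d → σt (ιT (X i)) = ιT (X i)) ∧ σt ^ 3 = 1 := by
  classical
  have hJ := algebraMap_v_mul_iv k n a b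
  have h2 := algebraMap_v'_mul_iv' k n a b
  have hV := algebraMap_v_eq k n a b
  have hV' := algebraMap_v'_eq k n a b
  have h3 := three_eq_zero_L k n a b
  -- the substitution `ψ₀ : k[x] → L`
  let φ₀ : MvPolynomial (Fin n) k →ₐ[k] LT := aeval (fun i : Fin n =>
    if i = b then ιT (X b * vT) else if i = a then ιT (X a) * ivT ^ 4
    else if i = c then ιT (X c) * ivT + ιT (X b ^ 3 * vT')
    else if i = d then ιT (X d + X b ^ 3 * X c ^ 3 - X b ^ 15 * X a ^ 2 * uT ^ 2 * X c)
    else ιT (X i))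
  have hφb : φ₀ (X b) = ιT (X b * vT) := by
    change aeval _ (X b) = _; rw [aeval_X]; simp
  have hφa : φ₀ (X a) = ιT (X a) * ivT ^ 4 := by
    change aeval _ (X a) = _; rw [aeval_X]; simp [hab]
  have hφc : φ₀ (X c) = ιT (X c) * ivT + ιT (X b ^ 3 * vT') := by
    change aeval _ (X c) = _; rw [aeval_X]; simp [hbc.symm, hac.symm]
  have hφd : φ₀ (X d) = ιT (X d + X b ^ 3 * X c ^ 3 - X b ^ 15 * X a ^ 2 * uT ^ 2 * X c) := by
    change aeval _ (X d) = _; rw [aeval_X]; simp [hbd.symm, had.symm, hcd.symm]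
  have hφi : ∀ i, i ≠ a → i ≠ b → i ≠ c → i ≠ d → φ₀ (X i) = ιT (X i) := by
    intro i h1 h2' h3' h4
    change aeval _ (X i) = _; rw [aeval_X]; simp [h1, h2', h3', h4]
  -- `ψ₀ u = v'·iv²` is a unit
  have hφu : φ₀ uT = ιT vT' * ivT ^ 2 := by
    have e : φ₀ uT = 1 - φ₀ (X b) ^ 6 * φ₀ (X a) ^ 2 := by
      simp only [map_sub, map_one, map_mul, map_pow]
    rw [e, hφb, hφa]
    simp only [map_mul]
    linear_combination (-(ιT vT * ivT + 1) - ιT (X b) ^ 6 * ιT (X a) ^ 2 * ivT ^ 2 *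
        ((ιT vT * ivT) ^ 5 + (ιT vT * ivT) ^ 4 + (ιT vT * ivT) ^ 3 + (ιT vT * ivT) ^ 2 +
          ιT vT * ivT + 1)) * hJ +
      (ivT ^ 2 * (ιT vT + 1 + ιT (X b) ^ 3 * ιT (X a))) * hV - (ivT ^ 2) * hV' +
      (ιT (X b) ^ 3 * ιT (X a) * ivT ^ 2) * h3
  have hiv : IsUnit ivT := IsUnit.of_mul_eq_one_right (ιT vT) hJ
  have hv'u : IsUnit (ιT vT') := IsUnit.of_mul_eq_one ivT' h2
  have hunit : IsUnit (φ₀ uT) := by rw [hφu]; exact hv'u.mul (hiv.pow 2)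
  -- the lift to `L`
  let τ₀ : LT →ₐ[k] LT := IsLocalization.Away.liftAlgHom (S := LT) uT (f := φ₀) hunit
  have hτ₀ : ∀ r, τ₀ (ιT r) = φ₀ r := fun r => by
    change IsLocalization.Away.liftAlgHom uT hunit (ιT r) = φ₀ r
    rw [IsLocalization.Away.liftAlgHom_apply, IsLocalization.Away.lift_eq]
    rfl
  have hS : τ₀ (ιT (X b)) = ιT (X b * vT) := by rw [hτ₀, hφb]
  have hA : τ₀ (ιT (X a)) = ιT (X a) * ivT ^ 4 := by rw [hτ₀, hφa]
  have hG : τ₀ (ιT (X c)) = ιT (X c) * ivT + ιT (X b ^ 3 * vT') := by rw [hτ₀, hφc]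
  have hW : τ₀ (ιT (X d)) = ιT (X d + X b ^ 3 * X c ^ 3 - X b ^ 15 * X a ^ 2 * uT ^ 2 * X c) := by
    rw [hτ₀, hφd]
  have hfix : ∀ i, i ≠ a → i ≠ b → i ≠ c → i ≠ d → τ₀ (ιT (X i)) = ιT (X i) := by
    intro i h1 h2' h3' h4; rw [hτ₀, hφi i h1 h2' h3' h4]
  -- `τ₀³ = id`, so `τ₀` is invertible
  have hcube := lift_cube_eq_id k n a b c d σ hb hc hd hσ hσ3 hab hac had hbc hbd hcd τ₀ hS hA hG hW hfix
  have hcube' : (τ₀.comp τ₀).comp τ₀ = AlgHom.id k LT := by rw [AlgHom.comp_assoc]; exact hcube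
  let σt : LT ≃ₐ[k] LT := AlgEquiv.ofAlgHom τ₀ (τ₀.comp τ₀) hcube hcube'
  have hσt : ∀ x, σt x = τ₀ x := fun x => rfl
  refine ⟨σt, ?_, ?_, ?_, ?_, ?_, ?_⟩
  · rw [hσt]; exact hS
  · rw [hσt]; exact hA
  · rw [hσt]; exact hG
  · rw [hσt]; exact hW
  · intro i h1 h2' h3' h4; rw [hσt]; exact hfix i h1 h2' h3' h4
  · ext x
    rw [pow_succ σt 2, pow_two σt, AlgEquiv.mul_apply, AlgEquiv.mul_apply, AlgEquiv.one_apply, hσt,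
      hσt, hσt]
    exact DFunLike.congr_fun hcube x

/-- Any lift with the law `σ̃ (ι S) = ι (S·v)` is **not the identity** (`ι` is injective and
`S·v − S = S⁴α ≠ 0`). [OURS · L1 W4.5c] -/
theorem twistedLift_ne_one (σt : LT ≃ₐ[k] LT) (hS : σt (ιT (X b)) = ιT (X b * vT)) :
    σt ≠ 1 := by
  classical
  intro h
  rw [h, AlgEquiv.one_apply] at hS
  have hu0 : uT ≠ 0 := by
    intro h0
    have h' := congrArg MvPolynomial.constantCoeff h0
    simp [MvPolynomial.constantCoeff_X] at h'
  have hinj : Function.Injective ιT :=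
    IsLocalization.injective LT (powers_le_nonZeroDivisors_of_noZeroDivisors hu0)
  have h1 := hinj hS
  have h2 : (X b ^ 4 * X a : MvPolynomial (Fin n) k) = 0 := by linear_combination (-1 : MvPolynomial (Fin n) k) * h1
  rcases mul_eq_zero.mp h2 with h3 | h3
  · exact X_ne_zero b (pow_eq_zero_iff (n := 4) (by norm_num) |>.mp h3)
  · exact X_ne_zero a h3

end Summit.ResolutionOfSingularities.ResolutionOfSingularities.Theorems.WildQuotientResolution.Z9Peeled

end
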